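import Summits.QuantumFields.YangMills.Theorems.BalabanUVNodesN22KernelLimitOfNestedTermsModel
import Literature.MathematicalPhysics.QuantumFieldTheory.Balaban1983to89.T4ActivityRecursionWitness

/-!
# THE NESTED-POLYMERS TOWER — GENERIC LEMMAS (A6 lane, dag-n22-w3): the Kotecký–Preiss objects of a PAIRWISE-INCOMPATIBLE family, `B13Resummation.locE` for activities supported on a
# strict CHAIN of polymers, and the (1.20) Hessian ∕ def-B's scalar kernel of a NONLINEAR on-site term

Cell `pub-ymgap`, Track A (HUMAN RULING D-0062), WIDTH SEAT `dag-n22-w3` g5 on node n22 = NE9, A6-residue lane; `--kind proof --supports stmt-QuantumFields-27366 --as helper` (KEY MAP v2: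
K3⁸), COUNT-NEUTRAL; THEOREMS ONLY (0 `def`, 0 `sorry`, standard axioms).  The engine of the sequels `…N22NestedPolymersTerms ∕ …Limit` (this seat), which fire the (1.21)-existence
schema of the lineage (p597055 `polLimitExists_sum_of_stable_tail`) at def-W1's `localizedSum` of a GENUINE `ClusterTower`.

* §1 [KP86] FOR A PAIRWISE-INCOMPATIBLE FINITE FAMILY (at most one polymer present): `isCompatible_iff_card_le_one_of_pairwise`, `polymerPartitionFunction_of_pairwise`
  (`Z(Λ; z) = 1 + Σ z`), `polymerRayDeriv_of_pairwise` (`d∕dt Z(Λ; tw) = Σ w`), ★ `polymerLogZ_of_pairwise` — the tree's Kotecký–Preiss logarithm (the ray integral of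
  `Literature.Probability.LatticeModels.polymerLogZ`) IS `Log(1 + Σ w)` when that number lies in the slit plane (generalising `T4ActivityRecursionWitness.polymerLogZ_singleton`).
* §2 ★★ `locE_chain_eq` ∕ `locE_chain_eq_zero` — B13's (2.13) `locE` (sum of [KP86] (3) truncated functionals over the covering families) for activities supported on a strict chain
  `γ 0, …, γ m` (injective, footprints strictly increasing and non-empty): the term of the footprint of `γ j` is `log Z(γ 0..γ j) − log Z(γ 0..γ (j−1))` (its covering families with
  non-zero truncated functional are exactly `{γ j} ∪ B`, `B ⊆ {γ 0..γ (j−1)}`: [KP86] (2) `polymerLogZ_eq_sum_truncatedWeight` + `Finset.sum_powerset_insert` +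
  `truncatedWeight_eq_zero_of_mem_of_eq_zero`), and every other footprint has term `0`.  The decidability and finiteness structures are taken as unification-bound implicit arguments
  (`{instD : DecidableEq Dom}` …) so that the lemmas apply to `W1.ClusterStep.E` with the instances it was elaborated with.
* §3 calculus: `expChart_onSiteFun`, `hasFDerivAt_comp_bondEval`, `fderiv_comp_bondEval`, `hasFDerivAt_fderiv_comp_bondEval`, ★ `polTensor_expChart_onSiteFun` (the (1.20) Hessian of the
  chart of `W ↦ f (W μ₀ x₀)` is on-site with weight `(f ∘ exp)″(0)` — dag-n18-w2's `polTensor_expChart_evalMul` is the linear case), ★ `polScalar_onSiteFun` (def-B's scalar kernel of a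
  nonlinear on-site term at the window sites: `[μ = ν = 0 ∧ window z = window 0] · (f ∘ exp)″(0)`), `polScalar_congr_expChart` (the kernel depends on the term only through its chart),
  (the logarithmic weight `ψ(A) = A∕(1+A)²` and its two inequalities are in `…N22NestedPolymersTerms` §0).

HONEST FRAMING (binding).  A MODEL-LEVEL A6 witness (test activities on def-T's catalogue, scalar probe algebra `𝔄 = ℝ`, `ρ = id`, one colour; the activities read the probe
configuration at ONE bond and do not read the couplings): NOT Bałaban's activities (2.9)–(2.11), NOT the towers OF RECORD, NOT a reading OF RECORD; inhabits NO letter OF RECORD;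
nothing of Bałaban's asserted or constructed; (1.21)'s existence for the terms OF RECORD is NOT proved; N22 NOT discharged; K3⁸ `SpineGivenEndpointR13SepCoPHV` OPEN, not claimed, no
stub touched; counts UNMOVED (typed 28∕28 · discharged 5∕27; the chair's single count line is the only count); one finite 𝕋⁴ programme at fixed ε — R4 closes the CONDITIONAL rung
`BalabanLadder.UV` only; NOTHING about the continuum limit, ℝ⁴, OS axioms or a mass gap is proved or claimed; the Yang–Mills mass gap (Clay) is NOT proved by any of this.  No cite
tags (Summit side); TYPES only: [I] = [Balaban1987RG1] CMP **109** (1987) (1.7) p. 261, (1.20)–(1.21) p. 264; [II] = [Balaban1988RG2Cluster] CMP **116** (1988) (2.9)–(2.14) pp. 14–15;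
[KP86] = Kotecký–Preiss, CMP **103** (1986) (2)–(3).
-/

noncomputable section

open Finset Filter Topology
open scoped BigOperators

namespace YMDAG.N22.AtKernels.NestedPolymers

open Literature.Probability.LatticeModels
open Literature.MathematicalPhysics.QuantumFieldTheory.Balaban1983to89
open Literature.MathematicalPhysics.QuantumFieldTheory.Balaban1983to89.T4ActivityRecursionWitness (one_add_mul_mem_slitPlane isCompatible_singleton)
open Literature.MathematicalPhysics.QuantumFieldTheory.Balaban1983to89.B13Resummation (locE)
open Literature.MathematicalPhysics.QuantumFieldTheory.Balaban1983to89.B13FamilySum (coveringFamilies mem_coveringFamilies)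
open Literature.MathematicalPhysics.QuantumFieldTheory.Balaban1983to89.TreeLengthTorus (TPt TAdj TStepIn TLinked TFaceConnected IsTDom TDom tsys
  tadj_update_add_one)
open Literature.MathematicalPhysics.QuantumFieldTheory.Balaban1983to89.TreeLengthTorusGeometry (TTouch ttouch_symm tgeometry)
open Literature.MathematicalPhysics.QuantumFieldTheory.Balaban1983to89.T4Continuum (T4Family)
open Literature.MathematicalPhysics.QuantumFieldTheory.Balaban1983to89.Node00 (siteOfInt polScalar polWindow polLimit PolLimitExists TermFamily1)
open Literature.MathematicalPhysics.QuantumFieldTheory.Balaban1983to89.Node00.Sect2 (domSys domCount CPair)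
open Literature.MathematicalPhysics.QuantumFieldTheory.Balaban1983to89.B14.Eq213MaximalDomains (side)
open Literature.MathematicalPhysics.QuantumFieldTheory.Balaban1983to89.Node00.W1 (ClusterStep ClusterTower)
open Literature.MathematicalPhysics.QuantumFieldTheory.Balaban1983to89.Node00.LocalizedSum17 (localizedSum ReadingMaps)
open Literature.MathematicalPhysics.QuantumFieldTheory.Balaban1983to89.Node00.U3KernelLetters (PolLimitsExist)
open Literature.MathematicalPhysics.QuantumFieldTheory.Balaban1983to89.Node00.U3OfKernels (histPrefix)
open YMDAG.N18.FiniteVolumeLettersModel (bondEval bondEval_apply siteOfInt_eventually_ne)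
open YMDAG.N22.AtKernels.NestedTermsModel (exists_threshold_siteOfInt)
open Literature.MathematicalPhysics.QuantumFieldTheory.Balaban1983to89.B12PolarizationTensor120 (polTensor polComp expChart)

/-! ## §1 The Kotecký–Preiss objects of a pairwise-incompatible family -/

section Pairwise

variable {P : Type*} [DecidableEq P] {inc : P → P → Prop} [DecidableRel inc]

omit [DecidableEq P] [DecidableRel inc] in
/-- In a pairwise-incompatible family the compatible sub-families are those with at most one member. -/
theorem isCompatible_iff_card_le_one_of_pairwise {Λ : Finset P} (hΛ : ∀ γ ∈ Λ, ∀ γ' ∈ Λ, γ ≠ γ' → inc γ γ')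
    {A : Finset P} (hA : A ⊆ Λ) : IsCompatible inc A ↔ A.card ≤ 1 := by
  rw [isCompatible_iff, Finset.card_le_one]
  constructor
  · intro h a ha b hb
    by_contra hab
    exact h a ha b hb hab (hΛ a (hA ha) b (hA hb) hab)
  · intro h a ha b hb hab
    exact absurd (h a ha b hb) hab

/-- **`Z(Λ; z) = 1 + Σ_{γ ∈ Λ} z γ` FOR A PAIRWISE-INCOMPATIBLE FAMILY** (only the empty family and the singletons are compatible). -/
theorem polymerPartitionFunction_of_pairwise {Λ : Finset P} (hΛ : ∀ γ ∈ Λ, ∀ γ' ∈ Λ, γ ≠ γ' → inc γ γ') (z : P → ℂ) :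
    polymerPartitionFunction inc z Λ = 1 + ∑ γ ∈ Λ, z γ := by
  unfold polymerPartitionFunction
  have hsplit : ∀ A ∈ Λ.powerset, (if IsCompatible inc A then ∏ γ ∈ A, z γ else 0) =
      (if A.card = 0 then (1 : ℂ) else 0) + ∑ γ ∈ Λ, (if A = {γ} then z γ else 0) := by
    intro A hA
    have hAΛ : A ⊆ Λ := Finset.mem_powerset.1 hA
    by_cases hc : IsCompatible inc A
    · rw [if_pos hc]
      have hcard : A.card ≤ 1 := (isCompatible_iff_card_le_one_of_pairwise hΛ hAΛ).1 hc
      rcases Nat.le_one_iff_eq_zero_or_eq_one.1 hcard with h0 | h1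
      · rw [Finset.card_eq_zero.1 h0]
        simp [Ne.symm (Finset.singleton_ne_empty _)]
      · obtain ⟨a, rfl⟩ := Finset.card_eq_one.1 h1
        have ha : a ∈ Λ := hAΛ (Finset.mem_singleton_self a)
        rw [Finset.prod_singleton, Finset.card_singleton, if_neg one_ne_zero, zero_add,
          Finset.sum_eq_single a (fun b _ hb => if_neg (fun h => hb (Finset.singleton_injective h).symm)) (fun h => (h ha).elim),
          if_pos rfl]
    · rw [if_neg hc]
      have hcard : ¬ A.card ≤ 1 := fun h => hc ((isCompatible_iff_card_le_one_of_pairwise hΛ hAΛ).2 h)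
      rw [if_neg (by omega), zero_add]
      refine (Finset.sum_eq_zero fun γ _ => if_neg fun h => hcard ?_).symm
      rw [h, Finset.card_singleton]
  rw [Finset.sum_congr rfl hsplit, Finset.sum_add_distrib, Finset.sum_comm]
  congr 1
  · simp_rw [Finset.card_eq_zero]
    rw [Finset.sum_ite_eq' Λ.powerset ∅ (fun _ => (1 : ℂ)), if_pos (Finset.mem_powerset.2 (Finset.empty_subset _))]
  · refine Finset.sum_congr rfl fun γ hγ => ?_
    rw [Finset.sum_ite_eq' Λ.powerset {γ} (fun _ => z γ), if_pos (Finset.mem_powerset.2 (Finset.singleton_subset_iff.2 hγ))]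

/-- **`d/dt Z(Λ; t w) = Σ_{γ ∈ Λ} w γ` FOR A PAIRWISE-INCOMPATIBLE FAMILY.** -/
theorem polymerRayDeriv_of_pairwise {Λ : Finset P} (hΛ : ∀ γ ∈ Λ, ∀ γ' ∈ Λ, γ ≠ γ' → inc γ γ') (w : P → ℂ) (t : ℝ) :
    polymerRayDeriv inc w Λ t = ∑ γ ∈ Λ, w γ := by
  unfold polymerRayDeriv
  rw [Finset.sum_filter]
  have hsplit : ∀ A ∈ Λ.powerset, (if IsCompatible inc A then (A.card : ℂ) * (t : ℂ) ^ (A.card - 1) * ∏ γ ∈ A, w γ else 0) =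
      ∑ γ ∈ Λ, (if A = {γ} then w γ else 0) := by
    intro A hA
    have hAΛ : A ⊆ Λ := Finset.mem_powerset.1 hA
    by_cases hc : IsCompatible inc A
    · rw [if_pos hc]
      have hcard : A.card ≤ 1 := (isCompatible_iff_card_le_one_of_pairwise hΛ hAΛ).1 hc
      rcases Nat.le_one_iff_eq_zero_or_eq_one.1 hcard with h0 | h1
      · rw [Finset.card_eq_zero.1 h0]
        simp [Ne.symm (Finset.singleton_ne_empty _)]
      · obtain ⟨a, rfl⟩ := Finset.card_eq_one.1 h1
        have ha : a ∈ Λ := hAΛ (Finset.mem_singleton_self a)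
        rw [Finset.prod_singleton, Finset.card_singleton,
          Finset.sum_eq_single a (fun b _ hb => if_neg (fun h => hb (Finset.singleton_injective h).symm)) (fun h => (h ha).elim),
          if_pos rfl]
        simp
    · rw [if_neg hc]
      have hcard : ¬ A.card ≤ 1 := fun h => hc ((isCompatible_iff_card_le_one_of_pairwise hΛ hAΛ).2 h)
      refine (Finset.sum_eq_zero fun γ _ => if_neg fun h => hcard ?_).symm
      rw [h, Finset.card_singleton]
  rw [Finset.sum_congr rfl hsplit, Finset.sum_comm]
  refine Finset.sum_congr rfl fun γ hγ => ?_
  rw [Finset.sum_ite_eq' Λ.powerset {γ} (fun _ => w γ), if_pos (Finset.mem_powerset.2 (Finset.singleton_subset_iff.2 hγ))]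

/-- **THE KOTECKÝ–PREISS LOGARITHM OF A PAIRWISE-INCOMPATIBLE FAMILY IS `Log(1 + Σ w)`** (the ray integral `∫₀¹ S∕(1 + tS) dt`, `S = Σ_{γ∈Λ} w γ`,
`1 + S` in the slit plane; the singleton case is `polymerLogZ_singleton`). -/
theorem polymerLogZ_of_pairwise {Λ : Finset P} (hΛ : ∀ γ ∈ Λ, ∀ γ' ∈ Λ, γ ≠ γ' → inc γ γ') {w : P → ℂ}
    (h : 1 + ∑ γ ∈ Λ, w γ ∈ Complex.slitPlane) : polymerLogZ inc w Λ = Complex.log (1 + ∑ γ ∈ Λ, w γ) := by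
  set S : ℂ := ∑ γ ∈ Λ, w γ with hS
  have hseg : ∀ t ∈ Set.uIcc (0 : ℝ) 1, 1 + (t : ℂ) * S ∈ Complex.slitPlane := by
    intro t ht
    rw [Set.uIcc_of_le zero_le_one] at ht
    exact one_add_mul_mem_slitPlane h ht.1 ht.2
  have hderiv : ∀ t ∈ Set.uIcc (0 : ℝ) 1, HasDerivAt (fun s : ℝ => Complex.log (1 + (s : ℂ) * S)) (S / (1 + (t : ℂ) * S)) t := by
    intro t ht
    have h1 : HasDerivAt (fun s : ℂ => 1 + s * S) S (t : ℂ) := by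
      simpa using ((hasDerivAt_id (t : ℂ)).mul_const S).const_add 1
    have h2 : HasDerivAt (fun s : ℝ => 1 + (s : ℂ) * S) S t := h1.comp_ofReal
    have h3 := (Complex.hasDerivAt_log (hseg t ht)).comp t h2
    rw [div_eq_inv_mul]
    exact h3
  have hcont : ContinuousOn (fun t : ℝ => S / (1 + (t : ℂ) * S)) (Set.uIcc 0 1) :=
    continuousOn_const.div (by fun_prop) fun t ht => Complex.slitPlane_ne_zero (hseg t ht)
  have hint : ∀ t : ℝ, polymerRayDeriv inc w Λ t / polymerPartitionFunction inc (fun γ' => (t : ℂ) * w γ') Λ = S / (1 + (t : ℂ) * S) := by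
    intro t
    rw [polymerRayDeriv_of_pairwise hΛ, polymerPartitionFunction_of_pairwise hΛ, ← Finset.mul_sum]
  unfold polymerLogZ
  simp_rw [hint]
  rw [intervalIntegral.integral_eq_sub_of_hasDerivAt hderiv hcont.intervalIntegrable]
  simp [hS]

end Pairwise

/-! ## §2 `locE` for activities supported on a strict chain of polymers -/

section Chain

variable {Dom Cube : Type*} {instD : DecidableEq Dom} {instC : DecidableEq Cube} {instF : Fintype Dom}
variable {ι : Dom → Dom → Prop} {instι : DecidableRel ι}

/-- **CHAIN-SUPPORTED ACTIVITIES: THE (2.13) TERM OF THE `j`-TH POLYMER IS A DIFFERENCE OF TWO KOTECKÝ–PREISS LOGARITHMS.**  Activities `w` supported on a strict chain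
`γ 0, …, γ m` of polymers (injective, footprints strictly increasing, non-empty): the localized (2.13) term of the footprint of `γ j` is
`log Z({γ 0, …, γ j}) − log Z({γ 0, …, γ (j−1)})` — the covering families of that footprint with non-zero truncated functional are exactly `{γ j} ∪ B`,
`B ⊆ {γ 0, …, γ (j−1)}` (KP (2) `polymerLogZ_eq_sum_truncatedWeight` + `Finset.sum_powerset_insert`). -/
theorem locE_chain_eq [Std.Symm ι] (cubes : Dom → Finset Cube) (w : Dom → ℂ) (γ : ℕ → Dom) (m : ℕ)
    (hinj : Set.InjOn γ {i | i ≤ m}) (hsupp : ∀ Z, (∀ i ≤ m, Z ≠ γ i) → w Z = 0)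
    (hmono : ∀ i ≤ m, ∀ i' ≤ m, (cubes (γ i) ⊆ cubes (γ i') ↔ i ≤ i')) (hne : ∀ i ≤ m, (cubes (γ i)).Nonempty)
    {j : ℕ} (hj : j ≤ m) :
    locE ι cubes w (cubes (γ j)) =
      polymerLogZ ι w ((Finset.range (j + 1)).image γ) - polymerLogZ ι w ((Finset.range j).image γ) := by
  classical
  -- the families with possibly non-zero truncated functional covering `cubes (γ j)`
  set S : Finset Dom := (Finset.range j).image γ with hS
  have hγS : γ j ∉ S := by
    intro h
    obtain ⟨i, hi, hij⟩ := Finset.mem_image.1 h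
    have := hinj (show i ≤ m by simp at hi; omega) hj hij
    simp at hi; omega
  have hins : insert (γ j) S = (Finset.range (j + 1)).image γ := by
    rw [hS, Finset.range_add_one, Finset.image_insert]
  -- KP (2) on both families
  rw [← hins, polymerLogZ_eq_sum_truncatedWeight, polymerLogZ_eq_sum_truncatedWeight, Finset.sum_powerset_insert hγS, add_sub_cancel_left]
  -- locE = sum over the image of `insert (γ j)` of `S.powerset`
  unfold locE
  have himg : S.powerset.image (insert (γ j)) ⊆ coveringFamilies (Finset.univ : Finset Dom) cubes (cubes (γ j)) := by
    intro C hC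
    obtain ⟨B, hB, rfl⟩ := Finset.mem_image.1 hC
    rw [mem_coveringFamilies]
    refine ⟨Finset.subset_univ _, ?_⟩
    rw [Finset.biUnion_insert]
    refine Finset.union_eq_left.2 (Finset.biUnion_subset.2 fun Z hZ => ?_)
    obtain ⟨i, hi, rfl⟩ := Finset.mem_image.1 (Finset.mem_powerset.1 hB hZ)
    have hi' : i < j := Finset.mem_range.1 hi
    exact (hmono i (by omega) j hj).2 hi'.le
  rw [← Finset.sum_subset himg, Finset.sum_image]
  · -- injectivity of `insert (γ j)` on `S.powerset`
    intro B hB B' hB' h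
    rw [Finset.mem_coe, Finset.mem_powerset] at hB hB'
    have e1 : (insert (γ j) B).erase (γ j) = B := Finset.erase_insert fun h' => hγS (hB h')
    have e2 : (insert (γ j) B').erase (γ j) = B' := Finset.erase_insert fun h' => hγS (hB' h')
    rw [← e1, ← e2, h]
  · -- the other covering families have a zero truncated functional
    intro C hC hCT
    rw [mem_coveringFamilies] at hC
    by_cases hz : ∃ Z ∈ C, w Z = 0
    · obtain ⟨Z, hZ, hwZ⟩ := hz
      exact truncatedWeight_eq_zero_of_mem_of_eq_zero hZ hwZ
    · exfalso
      push Not at hz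
      -- every member of `C` is some `γ i`, `i ≤ j`
      have hmem : ∀ Z ∈ C, ∃ i ≤ j, Z = γ i := by
        intro Z hZ
        by_contra hcon
        push Not at hcon
        refine hz Z hZ (hsupp Z fun i hi hZi => ?_)
        have hsub : cubes (γ i) ⊆ cubes (γ j) := by
          rw [← hC.2, ← hZi]
          exact Finset.subset_biUnion_of_mem cubes hZ
        exact hcon i ((hmono i hi j hj).1 hsub) hZi
      -- `γ j ∈ C`: otherwise the union is inside `cubes (γ (j-1))` (or empty for `j = 0`)
      have hjC : γ j ∈ C := by
        by_contra hjC
        rcases Nat.eq_zero_or_pos j with hj0 | hjpos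
        · subst hj0
          have hCe : C = ∅ := Finset.eq_empty_of_forall_notMem fun Z hZ => by
            obtain ⟨i, hi, rfl⟩ := hmem Z hZ
            exact hjC (by rwa [Nat.le_zero.1 hi] at hZ)
          have := hC.2
          rw [hCe, Finset.biUnion_empty] at this
          exact (hne 0 hj).ne_empty this.symm
        · have hsub : C.biUnion cubes ⊆ cubes (γ (j - 1)) := Finset.biUnion_subset.2 fun Z hZ => by
            obtain ⟨i, hi, rfl⟩ := hmem Z hZ
            have hij : i ≠ j := fun h => hjC (h ▸ hZ)
            exact (hmono i (by omega) (j - 1) (by omega)).2 (by omega)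
          rw [hC.2] at hsub
          have := (hmono j hj (j - 1) (by omega)).1 hsub
          omega
      refine hCT (Finset.mem_image.2 ⟨C.erase (γ j), ?_, Finset.insert_erase hjC⟩)
      rw [Finset.mem_powerset]
      intro Z hZ
      rw [Finset.mem_erase] at hZ
      obtain ⟨i, hi, rfl⟩ := hmem Z hZ.2
      have hij : i ≠ j := fun h => hZ.1 (by rw [h])
      exact Finset.mem_image.2 ⟨i, Finset.mem_range.2 (by omega), rfl⟩

/-- **… AND EVERY OTHER (2.13) TERM VANISHES**: a footprint that is not one of the chain's has only covering families with a zero-activity member. -/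
theorem locE_chain_eq_zero [Std.Symm ι] (cubes : Dom → Finset Cube) (w : Dom → ℂ) (γ : ℕ → Dom) (m : ℕ)
    (hsupp : ∀ Z, (∀ i ≤ m, Z ≠ γ i) → w Z = 0)
    (hmono : ∀ i ≤ m, ∀ i' ≤ m, (cubes (γ i) ⊆ cubes (γ i') ↔ i ≤ i'))
    {X : Finset Cube} (hX : ∀ i ≤ m, X ≠ cubes (γ i)) : locE ι cubes w X = 0 := by
  classical
  unfold locE
  refine Finset.sum_eq_zero fun C hC => ?_
  rw [mem_coveringFamilies] at hC
  by_cases hz : ∃ Z ∈ C, w Z = 0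
  · obtain ⟨Z, hZ, hwZ⟩ := hz
    exact truncatedWeight_eq_zero_of_mem_of_eq_zero hZ hwZ
  push Not at hz
  have hmem : ∀ Z ∈ C, ∃ i ≤ m, Z = γ i := by
    intro Z hZ
    by_contra hcon
    push Not at hcon
    exact hz Z hZ (hsupp Z fun i hi hZi => hcon i hi hZi)
  rcases C.eq_empty_or_nonempty with hCe | hCne
  · subst hCe
    exact truncatedWeight_empty w
  · exfalso
    -- the largest index present
    obtain ⟨Z₀, hZ₀, hmax⟩ := Finset.exists_max_image C (fun Z => ((Finset.range (m + 1)).filter fun i => Z = γ i).sum id) hCne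
    obtain ⟨i₀, hi₀, rfl⟩ := hmem Z₀ hZ₀
    refine hX i₀ hi₀ ?_
    rw [← hC.2]
    refine Finset.Subset.antisymm (Finset.biUnion_subset.2 fun Z hZ => ?_) (Finset.subset_biUnion_of_mem cubes hZ₀)
    obtain ⟨i, hi, rfl⟩ := hmem Z hZ
    refine (hmono i hi i₀ hi₀).2 ?_
    -- the index label of `γ i` is `i`
    have hlab : ∀ i ≤ m, ((Finset.range (m + 1)).filter fun i' => γ i = γ i').sum id = i := by
      intro i hi
      have : ((Finset.range (m + 1)).filter fun i' => γ i = γ i') = {i} := by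
        ext i'
        simp only [Finset.mem_filter, Finset.mem_range, Finset.mem_singleton]
        constructor
        · rintro ⟨hi', h⟩
          have hi'm : i' ≤ m := by omega
          have hsub := (hmono i hi i' hi'm).1 (h ▸ Finset.Subset.rfl)
          have hsub' := (hmono i' hi'm i hi).1 (h ▸ Finset.Subset.rfl)
          omega
        · rintro rfl
          exact ⟨by omega, rfl⟩
      rw [this, Finset.sum_singleton, id]
    have := hmax (γ i) hZ
    rwa [hlab i hi, hlab i₀ hi₀] at this

end Chain

/-! ## §3 The (1.20) Hessian and def-B's scalar kernel of a nonlinear on-site term; the logarithmic weight -/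

section Calculus

variable {Λ T : Type*} [Fintype Λ] [Fintype T]

omit [Fintype Λ] [Fintype T] in
/-- The chart of `W ↦ f (W μ₀ x₀)` (scalar algebra, `ρ = id`) is `B ↦ f (e^{B μ₀ x₀})`. -/
theorem expChart_onSiteFun (f : ℝ → ℝ) (μ₀ : Λ) (x₀ : T) :
    expChart (F := ℝ) (fun W : Λ → T → ℝ => f (W μ₀ x₀)) (ContinuousLinearMap.id ℝ ℝ) = fun B => f (Real.exp (bondEval μ₀ x₀ B)) := by
  funext B
  simp [expChart, Real.exp_eq_exp_ℝ]

/-- First derivative of `B ↦ h (B μ₀ x₀)`. -/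
theorem hasFDerivAt_comp_bondEval {h h' : ℝ → ℝ} (hd : ∀ t, HasDerivAt h (h' t) t) (μ₀ : Λ) (x₀ : T) (B : Λ → T → ℝ) :
    HasFDerivAt (fun B : Λ → T → ℝ => h (bondEval μ₀ x₀ B)) ((h' (bondEval μ₀ x₀ B)) • bondEval μ₀ x₀) B :=
  (hd _).comp_hasFDerivAt B (bondEval μ₀ x₀).hasFDerivAt

/-- … as a function. -/
theorem fderiv_comp_bondEval {h h' : ℝ → ℝ} (hd : ∀ t, HasDerivAt h (h' t) t) (μ₀ : Λ) (x₀ : T) :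
    fderiv ℝ (fun B : Λ → T → ℝ => h (bondEval μ₀ x₀ B)) = fun B => (h' (bondEval μ₀ x₀ B)) • bondEval μ₀ x₀ :=
  funext fun B => (hasFDerivAt_comp_bondEval hd μ₀ x₀ B).fderiv

/-- Second derivative of `B ↦ h (B μ₀ x₀)`: `(h″(B μ₀ x₀) • ev) ⊗ ev`. -/
theorem hasFDerivAt_fderiv_comp_bondEval {h h' h'' : ℝ → ℝ} (hd1 : ∀ t, HasDerivAt h (h' t) t) (hd2 : ∀ t, HasDerivAt h' (h'' t) t)
    (μ₀ : Λ) (x₀ : T) (B : Λ → T → ℝ) :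
    HasFDerivAt (fderiv ℝ (fun B : Λ → T → ℝ => h (bondEval μ₀ x₀ B)))
      (((h'' (bondEval μ₀ x₀ B)) • bondEval μ₀ x₀).smulRight (bondEval μ₀ x₀)) B := by
  rw [fderiv_comp_bondEval hd1]
  exact ((hd2 _).comp_hasFDerivAt B (bondEval μ₀ x₀).hasFDerivAt).smul_const (bondEval μ₀ x₀)

/-- ★ **THE (1.20) HESSIAN OF THE CHART OF A NONLINEAR ON-SITE TERM IS ON-SITE WITH WEIGHT `(f ∘ exp)″(0)`**: for `ℰ W = f (W μ₀ x₀)` with `h = f ∘ exp` twice differentiable,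
`Π_{μν}(x, y)(v ⊗ w) = h″(0) · (δ_{μ,x}v)(μ₀, x₀) · (δ_{ν,y}w)(μ₀, x₀)`. -/
theorem polTensor_expChart_onSiteFun [DecidableEq Λ] [DecidableEq T] {f h' h'' : ℝ → ℝ}
    (hd1 : ∀ t, HasDerivAt (fun s => f (Real.exp s)) (h' t) t) (hd2 : ∀ t, HasDerivAt h' (h'' t) t)
    (μ₀ : Λ) (x₀ : T) (μ : Λ) (x : T) (v : ℝ) (ν : Λ) (y : T) (w : ℝ) :
    polTensor ℝ (expChart (F := ℝ) (fun W : Λ → T → ℝ => f (W μ₀ x₀)) (ContinuousLinearMap.id ℝ ℝ)) μ x v ν y w =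
      h'' 0 * (Pi.single μ (Pi.single x v) : Λ → T → ℝ) μ₀ x₀ * (Pi.single ν (Pi.single y w) : Λ → T → ℝ) μ₀ x₀ := by
  rw [B12PolarizationTensor120.polTensor_def, expChart_onSiteFun, (hasFDerivAt_fderiv_comp_bondEval hd1 hd2 μ₀ x₀ 0).fderiv]
  simp [mul_assoc]

end Calculus

section Kernel

variable (F : T4Family)

/-- ★ **def-B's SCALAR KERNEL OF A NONLINEAR ON-SITE TERM AT THE WINDOW SITES, IN CLOSED FORM**: for `W ↦ f (W 0 (siteOfInt F K j 0))` with `h = f ∘ exp` twice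
differentiable, the (1.20) scalar kernel at `(siteOfInt z, siteOfInt 0)` in directions `(μ, ν)` is `h″(0)` when `μ = ν = 0` and the window sends `z` to the torus origin, else `0`. -/
theorem polScalar_onSiteFun (K j : ℕ) {f h' h'' : ℝ → ℝ} (hd1 : ∀ t, HasDerivAt (fun s => f (Real.exp s)) (h' t) t) (hd2 : ∀ t, HasDerivAt h' (h'' t) t)
    (μ ν : Fin 4) (z : Fin 4 → ℤ) :
    polScalar (fun W : Fin (F.P K).d → Site (F.P K) j → ℝ => f (W (Fin.cast (F.P_d K).symm 0) (siteOfInt F K j 0))) (ContinuousLinearMap.id ℝ ℝ)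
        (Module.Basis.singleton Unit ℝ) (Fin.cast (F.P_d K).symm μ) (siteOfInt F K j z) (Fin.cast (F.P_d K).symm ν) (siteOfInt F K j 0) =
      if μ = 0 ∧ ν = 0 ∧ siteOfInt F K j z = siteOfInt F K j 0 then h'' 0 else 0 := by
  unfold polScalar
  simp only [polComp, Module.Basis.singleton_apply, Fintype.card_unique, Nat.cast_one, inv_one, one_mul, Finset.univ_unique,
    Finset.sum_singleton, polTensor_expChart_onSiteFun hd1 hd2]
  have hμ : ∀ μ' : Fin 4, (Fin.cast (F.P_d K).symm 0 = Fin.cast (F.P_d K).symm μ') ↔ μ' = 0 := fun μ' =>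
    ⟨fun h => (Fin.cast_injective _ h).symm, fun h => by rw [h]⟩
  simp only [Pi.single_apply, hμ]
  by_cases h0 : μ = 0 <;> by_cases h1 : ν = 0 <;> by_cases h2 : siteOfInt F K j z = siteOfInt F K j 0 <;> simp [h0, h1, h2, eq_comm]

/-- `polScalar` depends on the term functional only through its exponential chart. -/
theorem polScalar_congr_expChart {Λ T : Type*} [Fintype Λ] [Fintype T] [DecidableEq Λ] [DecidableEq T] {ℰ ℰ' : (Λ → T → ℝ) → ℝ}
    (h : expChart (F := ℝ) ℰ (ContinuousLinearMap.id ℝ ℝ) = expChart (F := ℝ) ℰ' (ContinuousLinearMap.id ℝ ℝ)) (μ : Λ) (x : T) (ν : Λ) (y : T) :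
    polScalar ℰ (ContinuousLinearMap.id ℝ ℝ) (Module.Basis.singleton Unit ℝ) μ x ν y =
      polScalar ℰ' (ContinuousLinearMap.id ℝ ℝ) (Module.Basis.singleton Unit ℝ) μ x ν y := by
  unfold polScalar polComp
  rw [h]

end Kernel

end YMDAG.N22.AtKernels.NestedPolymers

end
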